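import Mathlib
import HarnessLib
import Literature.Analysis.FluidPDE.Tao2016AveragedNS.CascadeFrontFloors

/-!
# Toward the d-UNIFORM THEOREM A′ for crux `TaoLadderRungTwoBreak.NoSurvivingDSSOne` (stmt-NavierStokesRegularity-20205):
# the scalar PLATEAU, GAP and THRESHOLD lemmas of `CascadeFrontFloors` WITH A LEAK TERM

MODEL statements about real functions (the scalar cores behind Tao-2016-§4 lattice profile systems); nothing here concerns the
Navier–Stokes equations; no stub, crux or summit is closed (`--supports stmt-NavierStokesRegularity-20205`).

WHY.  By the small-ratio normal form (`…NoSurvivingDSSOneSmallRatioNormalForm`) a surviving admissible DSS wave at scale ratio `1+ε₀`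
is, after rescaling, a profile family of the SAME table with damping `d = ε₀`, feed `Λ`, drain `Λ⁻¹` and O(1) lag `τ`; its weighted
energy `ẽ = e^{2dξ}E` obeys `ẽ' = 2(κ₁ f̃(·+τ) − κ₂ f̃)` with `κ₁/κ₂ = 1/μ ∈ (1, 1+ε₀]` (surviving side), i.e. the CONSERVATIVE
identity `e' = 2(f(·+T) − f)` of the tree's Theorem A′ (`CascadeFrontFloors.trailing_floor_of_wave_identity`, `d = 0`, `κ₁ = κ₂`)
plus a LEAK `r = 2(κ₁−κ₂)f̃(·+τ)` of relative size `O(ε₀)`, `|r(s)| ≤ ρ₀·e(s+T)·g(s)`.  This file re-proves Theorem A′'s scalar core for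
the identity-with-leak `e' = 2(f(s+T) − f(s)) + r(s)`:
* `window_identity_leak` — `e S − e s = 2(∫_S^{S+T} f − ∫_s^{s+T} f) + ∫_s^S r`;
* `plateau_of_small_mass_leak` — (PLATEAU) mass one lag ahead `≤ δ` with `8CTδ ≤ 1`, leak budget `4ρ₀A ≤ 1` (`∫g ≤ A` on every
  interval), `e` bounded on the half-line and `≤ L` arbitrarily far out ⟹ `e ≤ 4L` on the half-line (was `2L` without leak);
* `gap_bound_leak` — (GAP) one backward comparison step over a lag: `e ≤ 2·Ep·exp((2C(M+δ) + ρ₀M)T)` on `[a, a+T]`;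
* `threshold_point'` — (THRESHOLD) the first phase from `+∞` where the mass reaches `δ₀` (the tree's version is private);
* `trailing_floor_of_wave_identity_leak` — **THEOREM A′ WITH LEAK (scalar core)**: either `e ≤ 4L` everywhere (no front) or
  `δ₀² ≤ 8qL·exp((2C(M+δ₀) + ρ₀M)T)` — a trailing-level floor UNIFORM in the leak as long as `4ρ₀A ≤ 1`.
What remains for the bounded-complexity slice of K1(1) (next hand): the PROFILE-LEVEL application — feed the rescaled surviving wave
(`smallRatio_normalForm`: `IsSWave π Q A B ε₀ Λ Λ⁻¹ τ Ψ`, weighted energy `ẽ`, flux `f̃ = Λ⁻¹e^{2ε₀ξ}sFlux`, leak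
`r = 2(Λe^{−2ε₀τ} − Λ⁻¹)f̃(·+τ)`, `ρ₀ = 2(1/μ − 1)Λ⁻¹C_A ≤ 2ε₀C_A`, `A = ∫sMass`) into this core, then convert the trailing floor into
`1 − μ ≥ w₀/(C_A·∫sMass)` with Theorem B′ (`IsDSSWave.theoremBprime`) and the wake–throughput identity of `…NoSurvivingDSSOneActionFloor`.
HONEST LABEL: ⟨20205⟩, (ρ0) and every NS statement remain OPEN.
-/

noncomputable section

-- the summit and its single sub-problem share the name (CONVENTIONS §1)
set_option linter.dupNamespace false

namespace Summit.NavierStokesRegularity.NavierStokesRegularity.Theorems.NoSurvivingDSSOne.LeakyFront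

open Set Filter Topology MeasureTheory intervalIntegral

/-- **Window identity with leak**: if `e' = 2(f(·+T) − f) + r` then `e S − e s = 2(∫_S^{S+T} f − ∫_s^{s+T} f) + ∫_s^S r`.
[folklore] -/
theorem window_identity_leak {e f r : ℝ → ℝ} {T : ℝ} (hf_cont : Continuous f) (hr_cont : Continuous r)
    (hderiv : ∀ s, HasDerivAt e (2 * (f (s + T) - f s) + r s) s) (s S : ℝ) :
    e S - e s = 2 * ((∫ x in S..S + T, f x) - ∫ x in s..s + T, f x) + ∫ x in s..S, r x := by
  -- adapted from the (private) `window_identity` of Literature/…/CascadeFrontFloors.lean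
  have hfi : ∀ a b, IntervalIntegrable f MeasureTheory.volume a b := fun a b => hf_cont.intervalIntegrable a b
  have hfT : Continuous fun x => f (x + T) := hf_cont.comp (continuous_id.add continuous_const)
  have hcont' : Continuous fun x => 2 * (f (x + T) - f x) + r x := by fun_prop
  have hcA : Continuous fun x => 2 * (f (x + T) - f x) := by fun_prop
  have h1 := integral_eq_sub_of_hasDerivAt (fun x (_ : x ∈ uIcc s S) => hderiv x) (hcont'.intervalIntegrable s S)
  have h2 : (∫ x in s..S, 2 * (f (x + T) - f x) + r x) =
      2 * ((∫ x in s..S, f (x + T)) - ∫ x in s..S, f x) + ∫ x in s..S, r x := by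
    rw [intervalIntegral.integral_add (hcA.intervalIntegrable (μ := volume) s S)
      (hr_cont.intervalIntegrable (μ := volume) s S), intervalIntegral.integral_const_mul,
      intervalIntegral.integral_sub (hfT.intervalIntegrable (μ := volume) s S) (hfi s S)]
  have h3 : (∫ x in s..S, f (x + T)) = ∫ x in s + T..S + T, f x := intervalIntegral.integral_comp_add_right f T
  have h4 : (∫ x in s..S, f x) = (∫ x in s..s + T, f x) + ∫ x in s + T..S, f x :=
    (integral_add_adjacent_intervals (hfi _ _) (hfi _ _)).symm
  have h5 : (∫ x in s + T..S + T, f x) = (∫ x in s + T..S, f x) + ∫ x in S..S + T, f x :=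
    (integral_add_adjacent_intervals (hfi _ _) (hfi _ _)).symm
  rw [← h1, h2, h3, h4, h5]
  ring

/-- **Plateau lemma with leak.**  If the mass one lag ahead is `≤ δ` on `[s₁ − T, ∞)` with `8CTδ ≤ 1`, the leak obeys
`|r(s)| ≤ ρ₀ e(s+T) g(s)` with `∫_a^b g ≤ A` on every interval and `4ρ₀A ≤ 1`, `e` is bounded on `[s₁, ∞)` and drops to `≤ L`
arbitrarily far out, then `e ≤ 4L` on `[s₁, ∞)`.
[cite: Tao2016AveragedNS, §4 Lemma 4.1 (4.8)–(4.9) with (4.3); adapted from the cell theorem `plateau_of_small_mass` (CascadeFrontFloors)] -/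
theorem plateau_of_small_mass_leak {e f g r : ℝ → ℝ} {T C δ L B s₁ ρ₀ A : ℝ} (hT : 0 < T) (hC : 0 ≤ C)
    (hCTδ : 8 * C * T * δ ≤ 1) (hρ₀ : 0 ≤ ρ₀) (hρA : 4 * ρ₀ * A ≤ 1)
    (hf_cont : Continuous f) (hr_cont : Continuous r) (hg_cont : Continuous g)
    (he_nn : ∀ s, 0 ≤ e s) (hg_nn : ∀ s, 0 ≤ g s)
    (hderiv : ∀ s, HasDerivAt e (2 * (f (s + T) - f s) + r s) s)
    (hflux : ∀ σ, |f σ| ≤ C * e σ * g (σ - T)) (hr : ∀ s, |r s| ≤ ρ₀ * e (s + T) * g s)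
    (hgA : ∀ a b, a ≤ b → ∫ x in a..b, g x ≤ A)
    (hg : ∀ u, s₁ - T ≤ u → g u ≤ δ) (hB : ∀ s, s₁ ≤ s → e s ≤ B)
    (hfreq : ∀ S₀, ∃ S, S₀ ≤ S ∧ e S ≤ L) :
    ∀ s, s₁ ≤ s → e s ≤ 4 * L := by
  -- window bound (verbatim from the tree)
  have hwin : ∀ K, (∀ s, s₁ ≤ s → e s ≤ K) → ∀ a, s₁ ≤ a →
      |∫ x in a..a + T, f x| ≤ C * δ * K * T := by
    intro K hK a ha
    have hK0 : 0 ≤ K := le_trans (he_nn s₁) (hK s₁ le_rfl)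
    have hbound : ∀ x ∈ Set.uIoc a (a + T), ‖f x‖ ≤ C * δ * K := by
      intro x hx
      rw [uIoc_of_le (by linarith)] at hx
      have hex : e x ≤ K := hK x (by linarith [hx.1])
      have hgx : g (x - T) ≤ δ := hg (x - T) (by linarith [hx.1])
      rw [Real.norm_eq_abs]
      calc |f x| ≤ C * e x * g (x - T) := hflux x
        _ ≤ C * K * δ := mul_le_mul (mul_le_mul_of_nonneg_left hex hC) hgx (hg_nn _) (mul_nonneg hC hK0)
        _ = C * δ * K := by ring
    have h := norm_integral_le_of_norm_le_const hbound
    rw [show a + T - a = T by ring, abs_of_pos hT, Real.norm_eq_abs] at h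
    exact h
  -- leak bound on `[s, S]`, `s₁ ≤ s ≤ S`
  have hleak : ∀ K, (∀ s, s₁ ≤ s → e s ≤ K) → ∀ s S, s₁ ≤ s → s ≤ S →
      |∫ x in s..S, r x| ≤ ρ₀ * K * A := by
    intro K hK s S hs hsS
    have hK0 : 0 ≤ K := le_trans (he_nn s₁) (hK s₁ le_rfl)
    have hgi := (hg_cont.intervalIntegrable (μ := volume) s S).const_mul (ρ₀ * K)
    have h1 : |∫ x in s..S, r x| ≤ ∫ x in s..S, ρ₀ * K * g x := by
      rw [← Real.norm_eq_abs]
      refine intervalIntegral.norm_integral_le_of_norm_le hsS ?_ hgi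
      refine Eventually.of_forall fun x => fun hx => ?_
      rw [Real.norm_eq_abs]
      have hx' : s < x := hx.1
      calc |r x| ≤ ρ₀ * e (x + T) * g x := hr x
        _ ≤ ρ₀ * K * g x := mul_le_mul_of_nonneg_right (mul_le_mul_of_nonneg_left (hK _ (by linarith)) hρ₀) (hg_nn x)
    rw [intervalIntegral.integral_const_mul] at h1
    exact h1.trans (mul_le_mul_of_nonneg_left (hgA s S hsS) (mul_nonneg hρ₀ hK0))
  -- one improvement step: `e ≤ K ⟹ e ≤ L + 3K/4`
  have hstep : ∀ K, (∀ s, s₁ ≤ s → e s ≤ K) → ∀ s, s₁ ≤ s → e s ≤ L + 3 * K / 4 := by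
    intro K hK s hs
    have hK0 : 0 ≤ K := le_trans (he_nn s₁) (hK s₁ le_rfl)
    obtain ⟨S, hSs, hSL⟩ := hfreq s
    have hid := window_identity_leak hf_cont hr_cont hderiv s S
    have h1 := abs_le.mp (hwin K hK S (le_trans hs hSs))
    have h2 := abs_le.mp (hwin K hK s hs)
    have h3 := abs_le.mp (hleak K hK s S hs hSs)
    have h4 : 4 * (C * δ * K * T) ≤ K / 2 := by nlinarith [mul_nonneg hK0 (sub_nonneg.mpr hCTδ)]
    have h5 : ρ₀ * K * A ≤ K / 4 := by nlinarith [mul_nonneg hK0 (sub_nonneg.mpr hρA)]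
    linarith [h1.1, h1.2, h2.1, h2.2, h3.1, h3.2]
  -- iterate: `e ≤ 4L + B (3/4)^n`
  have hB0 : 0 ≤ B := le_trans (he_nn s₁) (hB s₁ le_rfl)
  have hL0 : 0 ≤ L := by obtain ⟨S, _, hSL⟩ := hfreq s₁; exact le_trans (he_nn S) hSL
  have hiter : ∀ n : ℕ, ∀ s, s₁ ≤ s → e s ≤ 4 * L + B * (3 / 4) ^ n := by
    intro n
    induction n with
    | zero => intro s hs; have := hB s hs; simp only [pow_zero, mul_one]; linarith
    | succ n ih =>
      intro s hs
      have := hstep _ ih s hs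
      have h2 : L + 3 * (4 * L + B * (3 / 4) ^ n) / 4 = 4 * L + B * (3 / 4) ^ (n + 1) := by rw [pow_succ]; ring
      linarith [h2]
  intro s hs
  refine le_of_forall_pos_le_add fun ε hε => ?_
  have hlim : Tendsto (fun n : ℕ => B * (3 / 4 : ℝ) ^ n) atTop (𝓝 (B * 0)) :=
    (tendsto_pow_atTop_nhds_zero_of_lt_one (by norm_num) (by norm_num)).const_mul B
  rw [mul_zero] at hlim
  obtain ⟨n, hn⟩ := (hlim.eventually (gt_mem_nhds hε)).exists
  linarith [hiter n s hs]

/-- **Gap lemma with leak** (one backward comparison step over a lag).  If `g ≤ δ` on `[a, ∞)`, `g ≤ M` everywhere, the leak obeys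
`|r(s)| ≤ ρ₀ e(s+T) g(s)` and `e ≤ Ep` on `[a + T, ∞)`, then `e ≤ 2·Ep·exp((2C(M+δ) + ρ₀M)·T)` on `[a, a + T]`.
[cite: Tao2016AveragedNS, §4 Lemma 4.1 (4.8)–(4.9) with (4.3); adapted from the cell theorem `gap_bound` (CascadeFrontFloors)] -/
theorem gap_bound_leak {e f g r : ℝ → ℝ} {T C δ M Ep a ρ₀ : ℝ} (hT : 0 < T) (hC : 0 ≤ C) (hδ : 0 ≤ δ)
    (hM : 0 ≤ M) (hE : 0 ≤ Ep) (hρ₀ : 0 ≤ ρ₀) (he_cont : Continuous e) (he_nn : ∀ s, 0 ≤ e s)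
    (hg_nn : ∀ s, 0 ≤ g s) (hderiv : ∀ s, HasDerivAt e (2 * (f (s + T) - f s) + r s) s)
    (hflux : ∀ σ, |f σ| ≤ C * e σ * g (σ - T)) (hr : ∀ s, |r s| ≤ ρ₀ * e (s + T) * g s)
    (hg : ∀ u, a ≤ u → g u ≤ δ) (hgM : ∀ u, g u ≤ M) (hplat : ∀ s, a + T ≤ s → e s ≤ Ep) :
    ∀ u, a ≤ u → u ≤ a + T → e u ≤ 2 * Ep * Real.exp ((2 * C * (M + δ) + ρ₀ * M) * T) := by
  intro u hau huT
  set k : ℝ := 2 * C * (M + δ) + ρ₀ * M with hk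
  have hk0 : 0 ≤ k := by rw [hk]; positivity
  set ψ : ℝ → ℝ := fun x => (e x + Ep) * Real.exp (k * x) with hψ
  have hderivψ : ∀ x, HasDerivAt ψ
      ((2 * (f (x + T) - f x) + r x) * Real.exp (k * x) + (e x + Ep) * (Real.exp (k * x) * k)) x := by
    intro x
    have h1 : HasDerivAt (fun x => e x + Ep) (2 * (f (x + T) - f x) + r x) x := (hderiv x).add_const Ep
    have h2 : HasDerivAt (fun x => Real.exp (k * x)) (Real.exp (k * x) * k) x := by
      have : HasDerivAt (fun x => k * x) k x := by simpa using (hasDerivAt_id x).const_mul k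
      simpa using this.exp
    exact h1.mul h2
  have hnonneg : ∀ x, a ≤ x → x ≤ a + T →
      0 ≤ (2 * (f (x + T) - f x) + r x) * Real.exp (k * x) + (e x + Ep) * (Real.exp (k * x) * k) := by
    intro x hax _hxT
    have hex := Real.exp_pos (k * x)
    have hf1 : |f (x + T)| ≤ C * Ep * δ := by
      calc |f (x + T)| ≤ C * e (x + T) * g (x + T - T) := hflux (x + T)
        _ = C * e (x + T) * g x := by rw [add_sub_cancel_right]
        _ ≤ C * Ep * δ := mul_le_mul (mul_le_mul_of_nonneg_left (hplat (x + T) (by linarith)) hC) (hg x hax)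
              (hg_nn x) (mul_nonneg hC hE)
    have hf2 : |f x| ≤ C * e x * M := by
      calc |f x| ≤ C * e x * g (x - T) := hflux x
        _ ≤ C * e x * M := mul_le_mul_of_nonneg_left (hgM _) (mul_nonneg hC (he_nn x))
    have hr1 : |r x| ≤ ρ₀ * Ep * M := by
      calc |r x| ≤ ρ₀ * e (x + T) * g x := hr x
        _ ≤ ρ₀ * Ep * M := mul_le_mul (mul_le_mul_of_nonneg_left (hplat (x + T) (by linarith)) hρ₀) (hgM x)
              (hg_nn x) (mul_nonneg hρ₀ hE)
    have hf1' := abs_le.mp hf1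
    have hf2' := abs_le.mp hf2
    have hr1' := abs_le.mp hr1
    have key : -(k * (e x + Ep)) ≤ 2 * (f (x + T) - f x) + r x := by
      rw [hk]
      have hδM : 0 ≤ δ * e x := mul_nonneg hδ (he_nn x)
      have h2 : 0 ≤ M * e x := mul_nonneg hM (he_nn x)
      nlinarith [hf1'.1, hf2'.2, hr1'.1, mul_nonneg hC hδM, mul_nonneg hρ₀ h2, mul_nonneg hC (mul_nonneg hM hE)]
    have h := mul_le_mul_of_nonneg_right key hex.le
    have hid : (e x + Ep) * (Real.exp (k * x) * k) = k * (e x + Ep) * Real.exp (k * x) := by ring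
    rw [hid]
    nlinarith
  have hcontψ : Continuous ψ := by
    have h1 : Continuous fun x => Real.exp (k * x) := Real.continuous_exp.comp (continuous_const.mul continuous_id)
    exact (he_cont.add continuous_const).mul h1
  have hmono : MonotoneOn ψ (Icc a (a + T)) :=
    monotoneOn_of_hasDerivWithinAt_nonneg (convex_Icc a (a + T)) hcontψ.continuousOn
      (fun x _ => (hderivψ x).hasDerivWithinAt)
      (fun x hx => by
        rw [interior_Icc] at hx
        exact hnonneg x hx.1.le hx.2.le)
  have hψle : ψ u ≤ ψ (a + T) := hmono ⟨hau, huT⟩ ⟨by linarith, le_rfl⟩ huT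
  have hsplit : Real.exp (k * (a + T)) = Real.exp (k * u) * Real.exp (k * (a + T - u)) := by
    rw [← Real.exp_add]; congr 1; ring
  have hpos := Real.exp_pos (k * u)
  have hψ' : (e u + Ep) * Real.exp (k * u) ≤ (2 * Ep * Real.exp (k * (a + T - u))) * Real.exp (k * u) := by
    calc (e u + Ep) * Real.exp (k * u) = ψ u := rfl
      _ ≤ ψ (a + T) := hψle
      _ = (e (a + T) + Ep) * Real.exp (k * (a + T)) := rfl
      _ ≤ (2 * Ep) * Real.exp (k * (a + T)) :=
          mul_le_mul_of_nonneg_right (by linarith [hplat (a + T) le_rfl]) (Real.exp_pos _).le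
      _ = (2 * Ep * Real.exp (k * (a + T - u))) * Real.exp (k * u) := by rw [hsplit]; ring
  have h3 : e u + Ep ≤ 2 * Ep * Real.exp (k * (a + T - u)) := le_of_mul_le_mul_right hψ' hpos
  have hexp_le : Real.exp (k * (a + T - u)) ≤ Real.exp (k * T) :=
    Real.exp_le_exp.mpr (mul_le_mul_of_nonneg_left (by linarith) hk0)
  have h4 : 2 * Ep * Real.exp (k * (a + T - u)) ≤ 2 * Ep * Real.exp (k * T) :=
    mul_le_mul_of_nonneg_left hexp_le (by positivity)
  linarith [h3, h4, hE]

/-- **Threshold point.**  For continuous `g` with `g ≤ δ₀` on a half-line: either `g ≤ δ₀` everywhere, or there is a phase `a` with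
`g ≤ δ₀` on `[a, ∞)` and `δ₀ ≤ g a` (the infimum of the admissible phases).  (Public copy of the tree's private `threshold_point`.)
[folklore] -/
theorem threshold_point' {g : ℝ → ℝ} (hg : Continuous g) {δ₀ a₀ : ℝ} (h : ∀ u, a₀ ≤ u → g u ≤ δ₀) :
    (∀ u, g u ≤ δ₀) ∨ ∃ a, (∀ u, a ≤ u → g u ≤ δ₀) ∧ δ₀ ≤ g a := by
  -- adapted from the (private) `threshold_point` of Literature/…/CascadeFrontFloors.lean
  set A : Set ℝ := {a | ∀ u, a ≤ u → g u ≤ δ₀} with hA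
  have hne : A.Nonempty := ⟨a₀, h⟩
  have hArepr : A = ⋂ u : ℝ, (fun a => g (max a u)) ⁻¹' Iic δ₀ := by
    ext a
    simp only [hA, Set.mem_setOf_eq, Set.mem_iInter, Set.mem_preimage, Set.mem_Iic]
    constructor
    · intro ha u; exact ha (max a u) (le_max_left _ _)
    · intro ha u hu; have := ha u; rwa [max_eq_right hu] at this
  have hclosed : IsClosed A := by
    rw [hArepr]
    exact isClosed_iInter fun u => isClosed_Iic.preimage (hg.comp (continuous_id.max continuous_const))
  by_cases hbdd : BddBelow A
  · right
    have hmem : sInf A ∈ A := hclosed.csInf_mem hne hbdd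
    refine ⟨sInf A, hmem, ?_⟩
    by_contra hlt
    push Not at hlt
    obtain ⟨η, hη, hη'⟩ := Metric.continuous_iff.mp hg (sInf A) (δ₀ - g (sInf A)) (by linarith)
    have hball : ∀ x, dist x (sInf A) < η → g x < δ₀ := by
      intro x hx
      have := hη' x hx
      rw [Real.dist_eq] at this
      have := (abs_lt.mp this).2
      linarith
    have hmem' : sInf A - η / 2 ∈ A := by
      intro u hu
      by_cases hu' : sInf A ≤ u
      · exact hmem u hu'
      · push Not at hu'
        have : dist u (sInf A) < η := by rw [Real.dist_eq, abs_lt]; constructor <;> linarith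
        exact (hball u this).le
    have := csInf_le hbdd hmem'
    linarith
  · left
    intro u
    rw [bddBelow_def] at hbdd
    push Not at hbdd
    obtain ⟨a, haA, hau⟩ := hbdd u
    exact haA u hau.le

/-- **THEOREM A′ WITH LEAK — scalar core.**  For the identity-with-leak `e' = 2(f(·+T) − f) + r` with `|f σ| ≤ C e(σ) g(σ−T)`,
`|r s| ≤ ρ₀ e(s+T) g(s)`, `g² ≤ q e`, `g ≤ M`, `∫_a^b g ≤ A` on every interval, `e` eventually `≤ L`, and parameters
`8CTδ₀ ≤ 1`, `4ρ₀A ≤ 1`: EITHER `e ≤ 4L` everywhere (no front) OR `δ₀² ≤ 8 q L · exp((2C(M+δ₀) + ρ₀M)·T)` — the trailing level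
`L` of a front is bounded below, uniformly in the leak as long as `4ρ₀A ≤ 1` (for the rescaled surviving DSS wave `ρ₀ = O(ε₀)`).
[cite: Tao2016AveragedNS, §4 Lemma 4.1 (4.8)–(4.9) with (4.3); adapted from the cell theorem `trailing_floor_of_wave_identity` (CascadeFrontFloors)] -/
theorem trailing_floor_of_wave_identity_leak
    {e f g r : ℝ → ℝ} {T C q M L δ₀ ρ₀ A : ℝ} (hT : 0 < T) (hC : 0 ≤ C) (hq : 0 ≤ q) (hM : 0 ≤ M)
    (hL : 0 ≤ L) (hδ₀ : 0 < δ₀) (hCTδ : 8 * C * T * δ₀ ≤ 1) (hρ₀ : 0 ≤ ρ₀) (hρA : 4 * ρ₀ * A ≤ 1)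
    (he_cont : Continuous e) (hf_cont : Continuous f) (hg_cont : Continuous g) (hr_cont : Continuous r)
    (he_nn : ∀ s, 0 ≤ e s) (hg_nn : ∀ s, 0 ≤ g s)
    (hderiv : ∀ s, HasDerivAt e (2 * (f (s + T) - f s) + r s) s)
    (hflux : ∀ σ, |f σ| ≤ C * e σ * g (σ - T)) (hr : ∀ s, |r s| ≤ ρ₀ * e (s + T) * g s)
    (hgA : ∀ a b, a ≤ b → ∫ x in a..b, g x ≤ A)
    (hge : ∀ s, g s ^ 2 ≤ q * e s) (hgM : ∀ s, g s ≤ M)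
    (hev : ∃ S₀, ∀ S, S₀ ≤ S → e S ≤ L) :
    (∀ s, e s ≤ 4 * L) ∨ δ₀ ^ 2 ≤ 8 * q * L * Real.exp ((2 * C * (M + δ₀) + ρ₀ * M) * T) := by
  -- adapted from `trailing_floor_of_wave_identity` (Literature/…/CascadeFrontFloors.lean)
  obtain ⟨S₀, hS₀⟩ := hev
  have hfreq : ∀ S₁, ∃ S, S₁ ≤ S ∧ e S ≤ L :=
    fun S₁ => ⟨max S₁ S₀, le_max_left _ _, hS₀ _ (le_max_right _ _)⟩
  have hbd : ∀ s₁, ∃ B, ∀ s, s₁ ≤ s → e s ≤ B := by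
    intro s₁
    obtain ⟨x₀, _, hx₀⟩ := (isCompact_Icc (a := s₁) (b := max s₁ S₀)).exists_isMaxOn
      (nonempty_Icc.mpr (le_max_left _ _)) he_cont.continuousOn
    refine ⟨max (e x₀) L, fun s hs => ?_⟩
    by_cases h : s ≤ max s₁ S₀
    · exact le_trans (hx₀ ⟨hs, h⟩) (le_max_left _ _)
    · push Not at h
      exact le_trans (hS₀ s (le_trans (le_max_right _ _) h.le)) (le_max_right _ _)
  have hexp : 1 ≤ Real.exp ((2 * C * (M + δ₀) + ρ₀ * M) * T) := Real.one_le_exp (by positivity)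
  by_cases hcase : δ₀ ^ 2 ≤ q * L
  · right
    nlinarith [hexp, mul_nonneg hq hL]
  push Not at hcase
  have hgev : ∀ u, S₀ ≤ u → g u ≤ δ₀ := by
    intro u hu
    have h1 : g u ^ 2 ≤ q * L := le_trans (hge u) (mul_le_mul_of_nonneg_left (hS₀ u hu) hq)
    by_contra hnot
    push Not at hnot
    have : δ₀ ^ 2 < g u ^ 2 := by nlinarith [hnot, hδ₀]
    linarith
  rcases threshold_point' hg_cont hgev with hall | ⟨a, ha, hga⟩
  · left
    intro s
    obtain ⟨B, hB⟩ := hbd s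
    exact plateau_of_small_mass_leak hT hC hCTδ hρ₀ hρA hf_cont hr_cont hg_cont he_nn hg_nn hderiv hflux hr hgA
      (fun u _ => hall u) hB hfreq s le_rfl
  · right
    obtain ⟨B, hB⟩ := hbd (a + T)
    have hplat : ∀ s, a + T ≤ s → e s ≤ 4 * L :=
      plateau_of_small_mass_leak hT hC hCTδ hρ₀ hρA hf_cont hr_cont hg_cont he_nn hg_nn hderiv hflux hr hgA
        (fun u hu => ha u (by linarith)) hB hfreq
    have hgap := gap_bound_leak hT hC hδ₀.le hM (by positivity : (0:ℝ) ≤ 4 * L) hρ₀ he_cont he_nn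
      hg_nn hderiv hflux hr ha hgM hplat a le_rfl (by linarith)
    have h1 : δ₀ ^ 2 ≤ g a ^ 2 := by nlinarith [hga, hδ₀]
    have h2 := hge a
    have h3 : q * e a ≤ q * (2 * (4 * L) * Real.exp ((2 * C * (M + δ₀) + ρ₀ * M) * T)) :=
      mul_le_mul_of_nonneg_left hgap hq
    linarith

end Summit.NavierStokesRegularity.NavierStokesRegularity.Theorems.NoSurvivingDSSOne.LeakyFront

end
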